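import Literature.IUT.HodgeTheaters.PMBaseModels
import Literature.IUT.HodgeTheaters.PMBaseStripsProofs

/-!
# Proofs over [IUTchI] §0 / Def 6.1 (iv) / Example 6.2: the algebra of `+`-full poly-isomorphisms

Mochizuki, *Inter-universal Teichmüller theory I*, §0 p. 33 (composites of poly-morphisms), §6
Definition 6.1 (iv) p. 157, Example 6.2 (i)–(iii) pp. 159–160, Definition 6.4 (i) p. 162, kurims
manuscript (May 2020). PROOF-ONLY companion (theorems, no definitions) to abc-iut-L5-t4's
`PMBaseModels.lean`, by the L5 discharge seat abc-iut-L5-t13: the calculus of `+`-full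
poly-isomorphisms of `𝒟`-prime-strips that the bridge statements (Def 6.4, Props 6.6–6.8) run on —
composition (`DStrip.polyComp`), conjugation (`DStrip.polyConj`), composition with `Aut^α(‡𝔇)` and the
resulting `{±1}^𝕍`-torsor of `+`-full poly-isomorphisms `𝔇₁ ⥲ 𝔇₂` (the mechanism of [IUTchI] Prop 6.6
(i) p. 165), and the identification of the model poly-isomorphisms `φ^{Θ±}_t` of Example 6.2 (i) with the
`+`-full poly-isomorphism through the identity.

Record only; [claim: Mochizuki2012, status: disputed]; nothing here takes a side on any disputed step.
-/

namespace Literature.IUT.HodgeTheaters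

open CategoryTheory

universe u

namespace PMBaseKit

variable {l : ℕ} {K : PMBaseKit.{u} l}

namespace DStrip

variable {D D₁ D₂ D₃ : K.DStrip}

/-! ### The algebra of `+`-full poly-isomorphisms (used by Def 6.4, Props 6.6–6.8) -/

/-- **Composition**: the composite of the `+`-full poly-isomorphisms through `φ : 𝔇₁ ⥲ 𝔇₂` and
`ψ : 𝔇₂ ⥲ 𝔇₃` is the `+`-full poly-isomorphism through `ψ ∘ φ` ([IUTchI] §0 p. 33 composite of
poly-morphisms; Def 6.1 (iv) p. 157). [claim: Mochizuki2012, status: disputed] -/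
theorem polyComp_plusFullPolyIso (φ : D₁.Iso D₂) (ψ : D₂.Iso D₃) :
    DStrip.polyComp (DStrip.plusFullPolyIso φ) (DStrip.plusFullPolyIso ψ) =
      DStrip.plusFullPolyIso (φ.trans ψ) := by
  ext h
  constructor
  · rintro ⟨f, hf, g, hg, rfl⟩
    rw [mem_plusFullPolyIso_iff] at hf hg ⊢
    intro v
    change K.labMap v (f v ≪≫ g v) = K.labMap v (φ v ≪≫ ψ v)
    rw [K.labMap_trans, K.labMap_trans, hf v, hg v]
  · rintro ⟨c, hc, rfl⟩
    exact ⟨φ, self_mem_plusFullPolyIso φ, fun v => ψ v ≪≫ c v, ⟨c, hc, rfl⟩,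
      funext fun v => by
        change (φ v ≪≫ ψ v) ≪≫ c v = φ v ≪≫ (ψ v ≪≫ c v)
        exact CategoryTheory.Iso.trans_assoc _ _ _⟩

/-- **Conjugation**: conjugating the `+`-full poly-isomorphism through `φ : 𝔇₁ ⥲ 𝔇₂` by isomorphisms
`a : 𝔇₁ ⥲ 𝔇₁'`, `b : 𝔇₂ ⥲ 𝔇₂'` gives the `+`-full poly-isomorphism through `b ∘ φ ∘ a⁻¹` ([IUTchI] Def 6.4
(i) p. 162 "conjugation by which maps `φ^{Θ±}_± ↦ †φ^{Θ±}_±`"). [claim: Mochizuki2012, status: disputed] -/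
theorem polyConj_plusFullPolyIso {D₁' D₂' : K.DStrip} (a : D₁.Iso D₁') (b : D₂.Iso D₂') (φ : D₁.Iso D₂) :
    DStrip.polyConj a b (DStrip.plusFullPolyIso φ) = DStrip.plusFullPolyIso ((a.symm.trans φ).trans b) := by
  ext h
  constructor
  · rintro ⟨f, hf, rfl⟩
    rw [mem_plusFullPolyIso_iff] at hf ⊢
    intro v
    change K.labMap v (((a v).symm ≪≫ f v) ≪≫ b v) = K.labMap v (((a v).symm ≪≫ φ v) ≪≫ b v)
    rw [K.labMap_trans, K.labMap_trans, K.labMap_trans, K.labMap_trans, hf v]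
  · intro hh
    rw [mem_plusFullPolyIso_iff] at hh
    refine ⟨fun v => a v ≪≫ h v ≪≫ (b v).symm, mem_plusFullPolyIso_iff.mpr fun v => ?_,
      funext fun v => ?_⟩
    · have hv := hh v
      change K.labMap v (h v) = K.labMap v (((a v).symm ≪≫ φ v) ≪≫ b v) at hv
      change K.labMap v (a v ≪≫ h v ≪≫ (b v).symm) = K.labMap v (φ v)
      rw [K.labMap_trans, K.labMap_trans, hv, K.labMap_trans, K.labMap_trans, labMap_symm, labMap_symm]
      ext x
      simp
    · change h v = ((a v).symm ≪≫ (a v ≪≫ h v ≪≫ (b v).symm)) ≪≫ b v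
      simp

/-- **Composition with `Aut^α(‡𝔇)`**: `(φ · Aut_+) · Aut^α(‡𝔇) = (φ ∘ a) · Aut_+` for any `a ∈ Aut^α(‡𝔇)`
(the action of the group `{±1}^𝕍` of [IUTchI] Example 6.2 (iii) on `+`-full poly-isomorphisms,
Prop 6.6 (i) p. 165). [claim: Mochizuki2012, status: disputed] -/
theorem polyComp_plusFullPolyIso_signedPolyAut (φ : D₁.Iso D₂) {α : K.V → ℤˣ} {a : D₂.Iso D₂}
    (ha : a ∈ D₂.signedPolyAut α) :
    DStrip.polyComp (DStrip.plusFullPolyIso φ) (D₂.signedPolyAut α) = DStrip.plusFullPolyIso (φ.trans a) := by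
  rw [signedPolyAut_eq_plusFullPolyIso ha, polyComp_plusFullPolyIso]

/-- Right cancellation: `φ · θ · Aut_+ = φ' · θ · Aut_+` implies `φ · Aut_+ = φ' · Aut_+`.
[claim: Mochizuki2012, status: disputed] -/
theorem plusFullPolyIso_trans_right_cancel {φ φ' : D₁.Iso D₂} (θ : D₂.Iso D₃)
    (h : DStrip.plusFullPolyIso (φ.trans θ) = DStrip.plusFullPolyIso (φ'.trans θ)) :
    DStrip.plusFullPolyIso φ = DStrip.plusFullPolyIso φ' := by
  rw [plusFullPolyIso_eq_iff] at h ⊢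
  intro v
  have hv := h v
  change K.labMap v (φ v ≪≫ θ v) = K.labMap v (φ' v ≪≫ θ v) at hv
  rw [K.labMap_trans, K.labMap_trans] at hv
  ext x
  simpa using congrArg (fun e => (K.labMap v (θ v)).symm (e x)) hv

/-- Relative signs: two `+`-full poly-isomorphisms `𝔇₁ ⥲ 𝔇₂` differ by a unique `Aut^α(𝔇₂)` — existence
part: `φ' · Aut_+ = (φ · Aut_+) · Aut^α(𝔇₂)` for the sign vector `α` of `φ⁻¹ ∘ φ'` ([IUTchI] Prop 6.6 (i)
p. 165: the `{±1}^𝕍`-torsor of `+`-full poly-isomorphisms). [claim: Mochizuki2012, status: disputed] -/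
theorem exists_signedPolyAut_polyComp_eq (φ φ' : D₁.Iso D₂) :
    ∃ α : K.V → ℤˣ, DStrip.polyComp (DStrip.plusFullPolyIso φ) (D₂.signedPolyAut α) =
      DStrip.plusFullPolyIso φ' := by
  obtain ⟨α, hα⟩ := exists_eq_signedPolyAut (D := D₂) ⟨φ.symm.trans φ', rfl⟩
  refine ⟨α, ?_⟩
  have hmem : φ.symm.trans φ' ∈ D₂.signedPolyAut α := hα ▸ self_mem_plusFullPolyIso _
  rw [polyComp_plusFullPolyIso_signedPolyAut φ hmem]
  congr 1
  funext v
  change φ v ≪≫ ((φ v).symm ≪≫ φ' v) = φ' v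
  simp

/-- … and uniqueness part: `(φ · Aut_+) · Aut^α = (φ · Aut_+) · Aut^{α'}` forces `α = α'`.
[claim: Mochizuki2012, status: disputed] -/
theorem signedPolyAut_eq_of_polyComp_eq (φ : D₁.Iso D₂) {α α' : K.V → ℤˣ}
    (h : DStrip.polyComp (DStrip.plusFullPolyIso φ) (D₂.signedPolyAut α) =
      DStrip.polyComp (DStrip.plusFullPolyIso φ) (D₂.signedPolyAut α')) : α = α' := by
  obtain ⟨a, ha⟩ := exists_mem_signedPolyAut D₂ α
  obtain ⟨a', ha'⟩ := exists_mem_signedPolyAut D₂ α'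
  rw [polyComp_plusFullPolyIso_signedPolyAut φ ha, polyComp_plusFullPolyIso_signedPolyAut φ ha',
    plusFullPolyIso_eq_iff] at h
  apply signedPolyAut_injective D₂
  rw [signedPolyAut_eq_plusFullPolyIso ha, signedPolyAut_eq_plusFullPolyIso ha', plusFullPolyIso_eq_iff]
  intro v
  have hv := h v
  change K.labMap v (φ v ≪≫ a v) = K.labMap v (φ v ≪≫ a' v) at hv
  rw [K.labMap_trans, K.labMap_trans] at hv
  ext x
  simpa using congrArg (fun e => e ((K.labMap v (φ v)).symm x)) hv

end DStrip

/-- The model poly-isomorphisms `φ^{Θ±}_t : 𝔇_t ⥲ 𝔇_≻` of [IUTchI] Example 6.2 (i) p. 160 ("the respective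
positive `+`-full poly-isomorphisms") are the `+`-full poly-isomorphism through the identity of the
tautological `𝒟`-prime-strip. [claim: Mochizuki2012, status: disputed] -/
theorem Ex62.poly_eq (K : PMBaseKit.{u} l) (t : ZMod l) :
    Ex62.poly K t = DStrip.plusFullPolyIso (DStrip.Iso.refl (DStrip.model K)) :=
  DStrip.signedPolyAut_eq_plusFullPolyIso (DStrip.refl_mem_signedPolyAut_one (DStrip.model K))

end PMBaseKit

end Literature.IUT.HodgeTheaters
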